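import Summits.Ventures.Crystal3D.Theorems.StickyWulffConstantNoReconstructionGainJointBoundTrig
import Mathlib.Data.Finset.Max
import HarnessLib

/-!
# Joint level/support bound — separation cores for the `1/20`-level row and two-band deep pairs

HONEST FRAMING. Part of the venture `Summits/Ventures/Crystal3D` (cell `crystal3d-full`), helper
`--supports` the crux `NoReconstructionGain` (stmt-Ventures-19144, route
`route-Ventures-StickyWulffConstant`), line `joint-level-support-bound`, stub
`stub_jointBound_levelHeavy20` (skeleton v2, β = 1/20).  Pure real analysis:

* `sep_level_core20`, `sep_level_level_core20` — deep–level and level–level separation cores for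
  `1/20`-level directions;
* `concave_quad_pos`, `sep_deep_core2`, `sep_deep_core_obtuse` — the deep–deep separation core with a
  depth lower bound on BOTH directions (acute thresholds by two concavity steps, obtuse thresholds by
  monotonicity), so that pairs of deep directions get the azimuthal separation of their depth bands;
* `arc_gt_deep_deep2`, `arc_gt_deep_deep_obtuse`, `arc_gt_deep_level20`, `arc_gt_level_level20` — the
  angular forms;
* `packing_lower_bound` — one-dimensional packing: points of an interval pairwise more than `δ` apart.

WHAT THIS IS NOT: any statement about packings of balls; rung F-C1 not moved.
-/

noncomputable section

namespace Summit.Ventures.Crystal3D.Theorems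

open Finset Real

/-! ### Level cores at `β = 1/20` -/

/-- **Deep–level clearance core, `1/20`-level.**  `c > 0`, `1/2 ≤ a ≤ a_hi`, `|h| ≤ 1/20`,
`a² + ρd² = 1`, `h² + ρl² = 1`, `ρd, ρl ≥ 0`, `(1/2 + a_hi/20)² < c² (399/400) (1 - a_hi²)`:
then `1/2 < c ρd ρl - a h`. -/
theorem sep_level_core20 (c ahi a h ρd ρl : ℝ) (hc : 0 < c)
    (hcond : (1 / 2 + ahi / 20) ^ 2 < c ^ 2 * (399 / 400) * (1 - ahi ^ 2))
    (ha : 1 / 2 ≤ a) (ha' : a ≤ ahi) (hh : |h| ≤ 1 / 20) (hρd : 0 ≤ ρd) (hρl : 0 ≤ ρl)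
    (hd : a ^ 2 + ρd ^ 2 = 1) (hl : h ^ 2 + ρl ^ 2 = 1) :
    1 / 2 < c * (ρd * ρl) - a * h := by
  have hh1 := (abs_le.1 hh).1
  have hh2 := (abs_le.1 hh).2
  have ha0 : 0 ≤ a := by linarith
  have hah : a * h ≤ a / 20 := by nlinarith
  have hhsq : h ^ 2 ≤ 1 / 400 := by nlinarith
  have hρl2 : 399 / 400 ≤ ρl ^ 2 := by linarith
  have hρd2 : 1 - ahi ^ 2 ≤ ρd ^ 2 := by nlinarith
  have hahi1 : 0 < 1 - ahi ^ 2 := by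
    by_contra hneg
    push Not at hneg
    have : c ^ 2 * (399 / 400) * (1 - ahi ^ 2) ≤ 0 :=
      mul_nonpos_of_nonneg_of_nonpos (by positivity) hneg
    nlinarith [sq_nonneg (1 / 2 + ahi / 20)]
  have key : (1 / 2 + a / 20) ^ 2 < (c * (ρd * ρl)) ^ 2 := by
    have e : (c * (ρd * ρl)) ^ 2 = c ^ 2 * (ρd ^ 2 * ρl ^ 2) := by ring
    rw [e]
    have h3 : (1 - ahi ^ 2) * (399 / 400) ≤ ρd ^ 2 * ρl ^ 2 :=
      mul_le_mul hρd2 hρl2 (by norm_num) (sq_nonneg _)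
    have h4 : c ^ 2 * (399 / 400) * (1 - ahi ^ 2) ≤ c ^ 2 * (ρd ^ 2 * ρl ^ 2) := by nlinarith
    have h5 : (1 / 2 + a / 20) ^ 2 ≤ (1 / 2 + ahi / 20) ^ 2 := by nlinarith
    linarith
  have hpos : 0 ≤ c * (ρd * ρl) := by positivity
  have := lt_of_pow_lt_pow_left₀ 2 hpos key
  linarith

/-- **Level–level separation core, `1/20`-level.**  `c > 201/399`: `1/2 < c ρ ρ' + h h'`. -/
theorem sep_level_level_core20 (c h h' ρ ρ' : ℝ) (hc : 201 / 399 < c) (hh : |h| ≤ 1 / 20)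
    (hh' : |h'| ≤ 1 / 20) (hρ : 0 ≤ ρ) (hρ' : 0 ≤ ρ') (h1 : h ^ 2 + ρ ^ 2 = 1)
    (h2 : h' ^ 2 + ρ' ^ 2 = 1) : 1 / 2 < c * (ρ * ρ') + h * h' := by
  have hh1 := (abs_le.1 hh).1
  have hh2 := (abs_le.1 hh).2
  have hh1' := (abs_le.1 hh').1
  have hh2' := (abs_le.1 hh').2
  have hhh : -(1 / 400) ≤ h * h' := by
    nlinarith [mul_nonneg (show (0:ℝ) ≤ 1/20 + h by linarith) (show (0:ℝ) ≤ 1/20 - h' by linarith),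
      mul_nonneg (show (0:ℝ) ≤ 1/20 - h by linarith) (show (0:ℝ) ≤ 1/20 + h' by linarith)]
  have hρ2 : 399 / 400 ≤ ρ ^ 2 := by nlinarith
  have hρ2' : 399 / 400 ≤ ρ' ^ 2 := by nlinarith
  have hρρ0 : 0 ≤ ρ * ρ' := mul_nonneg hρ hρ'
  have h3 : (399 / 400 : ℝ) * (399 / 400) ≤ (ρ * ρ') ^ 2 := by
    rw [mul_pow]; exact mul_le_mul hρ2 hρ2' (by norm_num) (sq_nonneg _)
  have hρρ : 399 / 400 ≤ ρ * ρ' := by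
    by_contra hlt
    push Not at hlt
    nlinarith [mul_pos (show (0:ℝ) < 399 / 400 - ρ * ρ' by linarith)
      (show (0:ℝ) < 399 / 400 + ρ * ρ' by linarith)]
  have hc0 : 0 < c := by linarith
  nlinarith [mul_le_mul_of_nonneg_left hρρ hc0.le]

/-! ### Two-band deep cores -/

/-- A concave quadratic which is positive at `x₀` and nonnegative at `x₁ > x₀` is positive on
`[x₀, x₁)`. -/
theorem concave_quad_pos (M N P x₀ x₁ x : ℝ) (hM : 0 ≤ M)
    (h0 : 0 < -M * x₀ ^ 2 + N * x₀ + P) (h1 : 0 ≤ -M * x₁ ^ 2 + N * x₁ + P)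
    (hx0 : x₀ ≤ x) (hx1 : x < x₁) : 0 < -M * x ^ 2 + N * x + P := by
  have key : (-M * x ^ 2 + N * x + P) * (x₁ - x₀) =
      (-M * x₀ ^ 2 + N * x₀ + P) * (x₁ - x) + (-M * x₁ ^ 2 + N * x₁ + P) * (x - x₀)
        + M * (x - x₀) * (x₁ - x) * (x₁ - x₀) := by ring
  have hd : 0 < x₁ - x₀ := by linarith
  have hA : 0 < (-M * x₀ ^ 2 + N * x₀ + P) * (x₁ - x) := mul_pos h0 (by linarith)
  have hB : 0 ≤ (-M * x₁ ^ 2 + N * x₁ + P) * (x - x₀) := mul_nonneg h1 (by linarith)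
  have hC : 0 ≤ M * (x - x₀) * (x₁ - x) * (x₁ - x₀) := by
    have := mul_nonneg (mul_nonneg (mul_nonneg hM (by linarith : (0:ℝ) ≤ x - x₀))
      (by linarith : (0:ℝ) ≤ x₁ - x)) hd.le
    linarith
  have hprod : 0 < (-M * x ^ 2 + N * x + P) * (x₁ - x₀) := by rw [key]; linarith
  by_contra hle
  push Not at hle
  have : (-M * x ^ 2 + N * x + P) * (x₁ - x₀) ≤ 0 := mul_nonpos_of_nonpos_of_nonneg hle hd.le
  linarith

/-- **Two-band deep–deep core, acute threshold.**  `c > 0`, `aᵢ ≥ aloᵢ ≥ 1/2`, `ρᵢ > 0`,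
`aᵢ² + ρᵢ² = 1`, and the corner condition `(1/2 - alo₁ alo₂)² < c² (1 - alo₁²)(1 - alo₂²)` (or
`alo₁ alo₂ ≥ 1/2`): then `1/2 < c ρ₁ ρ₂ + a₁ a₂`.  Two concavity steps (`concave_quad_pos`) from the
corner `(alo₁, alo₂)`. -/
theorem sep_deep_core2 (c alo₁ alo₂ a₁ a₂ ρ₁ ρ₂ : ℝ) (hc : 0 < c) (h1 : 1 / 2 ≤ alo₁)
    (h2 : 1 / 2 ≤ alo₂)
    (hcond : 1 / 2 ≤ alo₁ * alo₂ ∨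
      (1 / 2 - alo₁ * alo₂) ^ 2 < c ^ 2 * (1 - alo₁ ^ 2) * (1 - alo₂ ^ 2))
    (ha₁ : alo₁ ≤ a₁) (ha₂ : alo₂ ≤ a₂) (hρ₁ : 0 < ρ₁) (hρ₂ : 0 < ρ₂)
    (e₁ : a₁ ^ 2 + ρ₁ ^ 2 = 1) (e₂ : a₂ ^ 2 + ρ₂ ^ 2 = 1) :
    1 / 2 < c * (ρ₁ * ρ₂) + a₁ * a₂ := by
  have hpos : 0 < c * (ρ₁ * ρ₂) := by positivity
  by_cases hp : 1 / 2 ≤ a₁ * a₂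
  · linarith
  push Not at hp
  have ha₁0 : 0 < a₁ := by linarith
  have ha₂0 : 0 < a₂ := by linarith
  have halo : alo₁ * alo₂ < 1 / 2 :=
    lt_of_le_of_lt (mul_le_mul ha₁ ha₂ (by linarith) (by linarith)) hp
  rcases hcond with hge | hcorner
  · exact absurd hge (not_le.2 halo)
  have hc2 : 0 < c ^ 2 := by positivity
  have ha2sq : a₂ ^ 2 ≤ 1 := by nlinarith [sq_nonneg ρ₂]
  have halo1sq : 0 ≤ 1 - alo₁ ^ 2 := by
    have : alo₁ ^ 2 ≤ a₁ ^ 2 := pow_le_pow_left₀ (by linarith) ha₁ 2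
    nlinarith [sq_nonneg ρ₁]
  -- step 1 : F(alo₁, a₂) > 0, concave quadratic in the second variable on [alo₂, 1/(2 alo₁))
  have step1 : 0 < c ^ 2 * (1 - alo₁ ^ 2) * (1 - a₂ ^ 2) - (1 / 2 - alo₁ * a₂) ^ 2 := by
    set y₁ : ℝ := 1 / (2 * alo₁) with hy₁
    have hy₁' : alo₁ * y₁ = 1 / 2 := by rw [hy₁]; field_simp
    have hy₁le : y₁ ≤ 1 := by rw [hy₁, div_le_one (by linarith)]; linarith
    have hy₁0 : 0 ≤ y₁ := by rw [hy₁]; positivity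
    have hlt : a₂ < y₁ := by
      by_contra hge; push Not at hge
      have : alo₁ * y₁ ≤ a₁ * a₂ := mul_le_mul ha₁ hge hy₁0 (by linarith)
      linarith
    have iden : ∀ y : ℝ, -(c ^ 2 * (1 - alo₁ ^ 2) + alo₁ ^ 2) * y ^ 2 + alo₁ * y
        + (c ^ 2 * (1 - alo₁ ^ 2) - 1 / 4) =
        c ^ 2 * (1 - alo₁ ^ 2) * (1 - y ^ 2) - (1 / 2 - alo₁ * y) ^ 2 := fun y => by ring
    have h0 : 0 < -(c ^ 2 * (1 - alo₁ ^ 2) + alo₁ ^ 2) * alo₂ ^ 2 + alo₁ * alo₂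
        + (c ^ 2 * (1 - alo₁ ^ 2) - 1 / 4) := by rw [iden]; linarith
    have hq1 : 0 ≤ -(c ^ 2 * (1 - alo₁ ^ 2) + alo₁ ^ 2) * y₁ ^ 2 + alo₁ * y₁
        + (c ^ 2 * (1 - alo₁ ^ 2) - 1 / 4) := by
      rw [iden, hy₁']
      have hy2 : 0 ≤ 1 - y₁ ^ 2 := by
        rw [show 1 - y₁ ^ 2 = (1 - y₁) * (1 + y₁) by ring]
        exact mul_nonneg (by linarith) (by linarith)
      have := mul_nonneg (mul_nonneg hc2.le halo1sq) hy2
      norm_num; linarith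
    have h := concave_quad_pos (c ^ 2 * (1 - alo₁ ^ 2) + alo₁ ^ 2) alo₁ (c ^ 2 * (1 - alo₁ ^ 2) - 1 / 4)
      alo₂ y₁ a₂ (add_nonneg (mul_nonneg hc2.le halo1sq) (sq_nonneg _)) h0 hq1 ha₂ hlt
    rw [iden] at h
    exact h
  -- step 2 : F(a₁, a₂) > 0, concave quadratic in the first variable on [alo₁, 1/(2 a₂))
  have ha2sq' : 0 ≤ 1 - a₂ ^ 2 := by linarith
  have step2 : 0 < c ^ 2 * (1 - a₁ ^ 2) * (1 - a₂ ^ 2) - (1 / 2 - a₁ * a₂) ^ 2 := by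
    set x₁ : ℝ := 1 / (2 * a₂) with hx₁
    have hx₁' : x₁ * a₂ = 1 / 2 := by rw [hx₁]; field_simp
    have hx₁le : x₁ ≤ 1 := by rw [hx₁, div_le_one (by linarith)]; linarith
    have hx₁0 : 0 ≤ x₁ := by rw [hx₁]; positivity
    have hlt : a₁ < x₁ := by
      by_contra hge; push Not at hge
      have : x₁ * a₂ ≤ a₁ * a₂ := mul_le_mul_of_nonneg_right hge (by linarith)
      linarith
    have iden : ∀ x : ℝ, -(c ^ 2 * (1 - a₂ ^ 2) + a₂ ^ 2) * x ^ 2 + a₂ * x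
        + (c ^ 2 * (1 - a₂ ^ 2) - 1 / 4) =
        c ^ 2 * (1 - x ^ 2) * (1 - a₂ ^ 2) - (1 / 2 - x * a₂) ^ 2 := fun x => by ring
    have h0 : 0 < -(c ^ 2 * (1 - a₂ ^ 2) + a₂ ^ 2) * alo₁ ^ 2 + a₂ * alo₁
        + (c ^ 2 * (1 - a₂ ^ 2) - 1 / 4) := by rw [iden]; linarith
    have hq1 : 0 ≤ -(c ^ 2 * (1 - a₂ ^ 2) + a₂ ^ 2) * x₁ ^ 2 + a₂ * x₁
        + (c ^ 2 * (1 - a₂ ^ 2) - 1 / 4) := by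
      rw [iden, hx₁']
      have hx2 : 0 ≤ 1 - x₁ ^ 2 := by
        rw [show 1 - x₁ ^ 2 = (1 - x₁) * (1 + x₁) by ring]
        exact mul_nonneg (by linarith) (by linarith)
      have := mul_nonneg (mul_nonneg hc2.le hx2) ha2sq'
      norm_num; linarith
    have h := concave_quad_pos (c ^ 2 * (1 - a₂ ^ 2) + a₂ ^ 2) a₂ (c ^ 2 * (1 - a₂ ^ 2) - 1 / 4)
      alo₁ x₁ a₁ (add_nonneg (mul_nonneg hc2.le ha2sq') (sq_nonneg _)) h0 hq1 ha₁ hlt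
    rw [iden] at h
    exact h
  -- conclude
  have hsq : (1 / 2 - a₁ * a₂) ^ 2 < (c * (ρ₁ * ρ₂)) ^ 2 := by
    have hr1 : ρ₁ ^ 2 = 1 - a₁ ^ 2 := by linarith
    have hr2 : ρ₂ ^ 2 = 1 - a₂ ^ 2 := by linarith
    have e : (c * (ρ₁ * ρ₂)) ^ 2 = c ^ 2 * (1 - a₁ ^ 2) * (1 - a₂ ^ 2) := by
      rw [show (c * (ρ₁ * ρ₂)) ^ 2 = c ^ 2 * ρ₁ ^ 2 * ρ₂ ^ 2 by ring, hr1, hr2]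
    rw [e]; linarith
  have := lt_of_pow_lt_pow_left₀ 2 hpos.le hsq
  linarith

/-- **Two-band deep–deep core for bands with `alo₁ alo₂ > 1/2`** (used with obtuse thresholds):
`aᵢ ≥ aloᵢ ≥ 0`, `aᵢ² + ρᵢ² = 1` and `c² (1 - alo₁²)(1 - alo₂²) < (alo₁ alo₂ - 1/2)²` give
`1/2 < c ρ₁ ρ₂ + a₁ a₂` (monotonicity in the depths). -/
theorem sep_deep_core_obtuse (c alo₁ alo₂ a₁ a₂ ρ₁ ρ₂ : ℝ) (h1 : 0 ≤ alo₁)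
    (h2 : 0 ≤ alo₂) (hp : 1 / 2 < alo₁ * alo₂)
    (hcond : c ^ 2 * (1 - alo₁ ^ 2) * (1 - alo₂ ^ 2) < (alo₁ * alo₂ - 1 / 2) ^ 2)
    (ha₁ : alo₁ ≤ a₁) (ha₂ : alo₂ ≤ a₂)
    (e₁ : a₁ ^ 2 + ρ₁ ^ 2 = 1) (e₂ : a₂ ^ 2 + ρ₂ ^ 2 = 1) :
    1 / 2 < c * (ρ₁ * ρ₂) + a₁ * a₂ := by
  -- ρ₁ ρ₂ ≤ R := √((1-alo₁²)(1-alo₂²)) and |c| R < alo₁alo₂ - 1/2 ≤ a₁a₂ - 1/2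
  have hR1 : ρ₁ ^ 2 ≤ 1 - alo₁ ^ 2 := by nlinarith
  have hR2 : ρ₂ ^ 2 ≤ 1 - alo₂ ^ 2 := by nlinarith
  have hRR : (ρ₁ * ρ₂) ^ 2 ≤ (1 - alo₁ ^ 2) * (1 - alo₂ ^ 2) := by
    rw [mul_pow]; exact mul_le_mul hR1 hR2 (sq_nonneg _) (by nlinarith)
  have haa : alo₁ * alo₂ ≤ a₁ * a₂ := mul_le_mul ha₁ ha₂ h2 (by linarith)
  -- (|c| ρ₁ρ₂)² ≤ c² (1-alo₁²)(1-alo₂²) < (alo₁alo₂ - 1/2)²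
  have hsq : (-c * (ρ₁ * ρ₂)) ^ 2 < (alo₁ * alo₂ - 1 / 2) ^ 2 := by
    have : (-c * (ρ₁ * ρ₂)) ^ 2 = c ^ 2 * (ρ₁ * ρ₂) ^ 2 := by ring
    rw [this]
    have hc2 : 0 ≤ c ^ 2 := sq_nonneg _
    nlinarith [mul_le_mul_of_nonneg_left hRR hc2]
  have hpos : 0 ≤ alo₁ * alo₂ - 1 / 2 := by linarith
  have habs := abs_lt_of_sq_lt_sq' hsq hpos
  linarith [habs.1, habs.2, haa]

/-! ### Angular forms -/

/-- Deep–deep arc, two bands, acute threshold. -/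
theorem arc_gt_deep_deep2 (c τ alo₁ alo₂ z₁ z₂ ρ₁ ρ₂ x : ℝ) (hc : 0 < c) (hcτ : c < Real.cos τ)
    (hτ : τ ≤ π) (h1 : 1 / 2 ≤ alo₁) (h2 : 1 / 2 ≤ alo₂)
    (hcond : 1 / 2 ≤ alo₁ * alo₂ ∨
      (1 / 2 - alo₁ * alo₂) ^ 2 < c ^ 2 * (1 - alo₁ ^ 2) * (1 - alo₂ ^ 2))
    (hz₁ : z₁ ≤ -alo₁) (hz₂ : z₂ ≤ -alo₂) (hρ₁ : 0 < ρ₁) (hρ₂ : 0 < ρ₂)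
    (e₁ : z₁ ^ 2 + ρ₁ ^ 2 = 1) (e₂ : z₂ ^ 2 + ρ₂ ^ 2 = 1) (hx : 0 ≤ x)
    (hsep : ρ₁ * ρ₂ * Real.cos x + z₁ * z₂ ≤ 1 / 2) : τ < x := by
  refine lt_of_cos_lt_cos_of_nonneg hx hτ ?_
  by_contra hle
  push Not at hle
  have key := sep_deep_core2 c alo₁ alo₂ (-z₁) (-z₂) ρ₁ ρ₂ hc h1 h2 hcond (by linarith)
    (by linarith) hρ₁ hρ₂ (by nlinarith) (by nlinarith)
  have : c * (ρ₁ * ρ₂) ≤ ρ₁ * ρ₂ * Real.cos x := by nlinarith [mul_pos hρ₁ hρ₂]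
  nlinarith

/-- Deep–deep arc, two bands, for depth bands with `alo₁ alo₂ > 1/2` (obtuse thresholds, `cos τ`
may be negative). -/
theorem arc_gt_deep_deep_obtuse (c τ alo₁ alo₂ z₁ z₂ ρ₁ ρ₂ x : ℝ)
    (hcτ : c < Real.cos τ) (hτ : τ ≤ π) (h1 : 0 ≤ alo₁) (h2 : 0 ≤ alo₂)
    (hp : 1 / 2 < alo₁ * alo₂)
    (hcond : c ^ 2 * (1 - alo₁ ^ 2) * (1 - alo₂ ^ 2) < (alo₁ * alo₂ - 1 / 2) ^ 2)
    (hz₁ : z₁ ≤ -alo₁) (hz₂ : z₂ ≤ -alo₂) (hρ₁ : 0 ≤ ρ₁) (hρ₂ : 0 ≤ ρ₂)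
    (e₁ : z₁ ^ 2 + ρ₁ ^ 2 = 1) (e₂ : z₂ ^ 2 + ρ₂ ^ 2 = 1) (hx : 0 ≤ x)
    (hsep : ρ₁ * ρ₂ * Real.cos x + z₁ * z₂ ≤ 1 / 2) : τ < x := by
  refine lt_of_cos_lt_cos_of_nonneg hx hτ ?_
  by_contra hle
  push Not at hle
  have key := sep_deep_core_obtuse c alo₁ alo₂ (-z₁) (-z₂) ρ₁ ρ₂ h1 h2 hp hcond (by linarith)
    (by linarith) (by nlinarith) (by nlinarith)
  have : c * (ρ₁ * ρ₂) ≤ ρ₁ * ρ₂ * Real.cos x := by nlinarith [mul_nonneg hρ₁ hρ₂]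
  nlinarith

/-- Deep–level arc, `1/20`-level. -/
theorem arc_gt_deep_level20 (c τ ahi z₁ z₂ ρ₁ ρ₂ x : ℝ) (hc : 0 < c) (hcτ : c < Real.cos τ)
    (hτ : τ ≤ π) (hcond : (1 / 2 + ahi / 20) ^ 2 < c ^ 2 * (399 / 400) * (1 - ahi ^ 2))
    (hz₁ : z₁ ≤ -(1 / 2)) (hz₁' : -ahi ≤ z₁) (hz₂ : |z₂| ≤ 1 / 20) (hρ₁ : 0 ≤ ρ₁) (hρ₂ : 0 ≤ ρ₂)
    (e₁ : z₁ ^ 2 + ρ₁ ^ 2 = 1) (e₂ : z₂ ^ 2 + ρ₂ ^ 2 = 1) (hx : 0 ≤ x)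
    (hsep : ρ₁ * ρ₂ * Real.cos x + z₁ * z₂ ≤ 1 / 2) : τ < x := by
  refine lt_of_cos_lt_cos_of_nonneg hx hτ ?_
  by_contra hle
  push Not at hle
  have key := sep_level_core20 c ahi (-z₁) z₂ ρ₁ ρ₂ hc hcond (by linarith) (by linarith) hz₂ hρ₁ hρ₂
    (by nlinarith) e₂
  have : c * (ρ₁ * ρ₂) ≤ ρ₁ * ρ₂ * Real.cos x := by nlinarith [mul_nonneg hρ₁ hρ₂]
  nlinarith

/-- Level–level arc, `1/20`-level. -/
theorem arc_gt_level_level20 (c τ z₁ z₂ ρ₁ ρ₂ x : ℝ) (hc : 201 / 399 < c) (hcτ : c < Real.cos τ)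
    (hτ : τ ≤ π) (hz₁ : |z₁| ≤ 1 / 20) (hz₂ : |z₂| ≤ 1 / 20) (hρ₁ : 0 ≤ ρ₁) (hρ₂ : 0 ≤ ρ₂)
    (e₁ : z₁ ^ 2 + ρ₁ ^ 2 = 1) (e₂ : z₂ ^ 2 + ρ₂ ^ 2 = 1) (hx : 0 ≤ x)
    (hsep : ρ₁ * ρ₂ * Real.cos x + z₁ * z₂ ≤ 1 / 2) : τ < x := by
  refine lt_of_cos_lt_cos_of_nonneg hx hτ ?_
  by_contra hle
  push Not at hle
  have key := sep_level_level_core20 c z₁ z₂ ρ₁ ρ₂ hc hz₁ hz₂ hρ₁ hρ₂ e₁ e₂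
  have : c * (ρ₁ * ρ₂) ≤ ρ₁ * ρ₂ * Real.cos x := by
    have hc0 : 0 < c := by linarith
    nlinarith [mul_nonneg hρ₁ hρ₂]
  nlinarith

/-! ### One-dimensional packing -/

/-- **1-D packing.**  A nonempty finite set of reals in `[lo, hi]` whose distinct elements are more
than `δ` apart satisfies `lo + (card - 1) δ ≤ hi`. -/
theorem packing_lower_bound (δ lo hi : ℝ) :
    ∀ n : ℕ, ∀ S : Finset ℝ, S.card = n + 1 → (∀ x ∈ S, lo ≤ x ∧ x ≤ hi) →
      (∀ x ∈ S, ∀ y ∈ S, x ≠ y → δ < |x - y|) → lo + n * δ ≤ hi := by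
  intro n
  induction n generalizing lo with
  | zero =>
    intro S hS hin _
    obtain ⟨x, hx⟩ : S.Nonempty := card_pos.1 (by omega)
    have := hin x hx
    simp; linarith [this.1, this.2]
  | succ n ih =>
    intro S hS hin hsep
    have hne : S.Nonempty := card_pos.1 (by omega)
    set m := S.min' hne with hm
    have hmS : m ∈ S := min'_mem S hne
    have hmin : ∀ x ∈ S, m ≤ x := fun x hx => min'_le S x hx
    set S' := S.erase m with hS'
    have hcard : S'.card = n + 1 := by rw [hS', card_erase_of_mem hmS, hS]; rfl
    have hlo : lo ≤ m := (hin m hmS).1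
    have hin' : ∀ x ∈ S', m + δ ≤ x ∧ x ≤ hi := by
      intro x hx
      have hxS : x ∈ S := mem_of_mem_erase hx
      have hxm : x ≠ m := ne_of_mem_erase hx
      have h1 := hsep x hxS m hmS hxm
      have h2 := hmin x hxS
      rw [abs_of_nonneg (by linarith)] at h1
      exact ⟨by linarith, (hin x hxS).2⟩
    have := ih (m + δ) S' hcard hin' (fun x hx y hy hxy =>
      hsep x (mem_of_mem_erase hx) y (mem_of_mem_erase hy) hxy)
    push_cast at this ⊢
    nlinarith

end Summit.Ventures.Crystal3D.Theorems

end
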